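import Literature.Geometry.Riemannian.PICSphereFactsProofs
import Literature.Topology.FourManifolds.ConnectedSumClosure
import Literature.Topology.FourManifolds.MappingTorusCovering
import Literature.Topology.FourManifolds.RealProjectiveSpace
import Literature.Topology.FourManifolds.ClosedBallProofs
import Literature.Topology.FourManifolds.MappingTorusTransportProofs
import HarnessLib

/-!
# Hamilton's Main Theorem 1.1 with its printed list of pieces, and the deduction of Cor. 1.2(a)

Refinement of the decomposition of the named fact `Literature.Geometry.Riemannian.hamilton_pic_sphere_four`
(`PICSphereFacts.lean`; Hamilton 1997, Cor. 1.2(a): a compact simply connected PIC 4-manifold is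
diffeomorphic to `S⁴`). `PICSphereFactsProofs.lean` reduced it (with proof) to
`Literature.Geometry.Riemannian.hamilton_pic_connectedSum_spheres_four` ("… is a connected sum of copies of `S⁴`"),
whose statement still contains the topological deduction "`π₁ = 1` ⇒ only `S⁴` summands". Here
that deduction is carried out in Lean, so that the remaining named fact is Hamilton's Main
Theorem 1.1 *with its printed conclusion*:

> **Theorem 1.1 (Hamilton, Comm. Anal. Geom. 5 (1997), p. 2).** Let `M⁴` be a compact
> four-manifold with no essential incompressible space-form. Then `M⁴` admits a metric of positive
> isotropic curvature if and only if `M⁴` is diffeomorphic to the sphere `S⁴`, the projective space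
> `RP⁴`, the product `S³ × S¹`, the twisted product `S³ ×~ S¹` which is the only unoriented `S³`
> bundle over `S¹`, or a connected sum of the above.

* `Literature.Lorentz.IsHamiltonPICPiece X`: `X` (a charted space on `ℝ⁴`) is one of the four model
  pieces, each rendered by the tree's relational predicates: `X ≅ 𝕊⁴` (a `Diffeomorph`);
  `Literature.IsRealProjectiveSpace 4 X` (`RealProjectiveSpace.lean`: `X = 𝕊⁴/±1` with the antipodal
  involution — the *standard* `RP⁴`, as the theorem requires: "the standard `RP⁴` admits a metric
  of positive isotropic curvature, but the fake one does not", p. 3); `Literature.IsMappingTorusOf (𝓡 4) X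
  (Diffeomorph.refl 𝕊³)` (`S³ × S¹`, the mapping torus of the identity, i.e. the oriented `S³`
  bundle over `S¹`); `Literature.IsMappingTorusOf (𝓡 4) X (Literature.sphereReflection e₀)` (`S³ ×~ S¹`, the
  mapping torus of a reflection of `S³`, "the only unoriented `S³` bundle over `S¹`").
* `Literature.Geometry.Riemannian.hamilton_pic_classification_four` (NAMED FACT): Thm. 1.1, "only if" direction, in
  the case `π₁(M) = 1` (where the space-form hypothesis is vacuous: an incompressible space form
  `S³/Γ ⊂ M` has `Γ ↪ π₁(M) = 1`, hence is inessential): a closed simply connected PIC 4-manifold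
  belongs to the closure `Literature.IsConnectedSumOf 4 IsHamiltonPICPiece` of the four pieces under
  connected sums (`ConnectedSumClosure.lean`).
* PROVED: `Literature.Geometry.Riemannian.IsHamiltonPICPiece.nonempty_diffeomorph_sphere_of_simplyConnectedSpace` —
  the only simply connected piece is `S⁴`: `π₁(RP⁴) ≠ 1`
  (`IsRealProjectiveSpace.not_simplyConnectedSpace`), `π₁(S³ × S¹) ≠ 1 ≠ π₁(S³ ×~ S¹)`
  (`IsMappingTorusOf.not_simplyConnectedSpace`);
  `Literature.Geometry.Riemannian.hamilton_pic_connectedSum_spheres_four_of_classification` — Thm. 1.1 (this form)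
  implies the connected-sum-of-spheres form, by `π₁(M # N) = 1 ⇒ π₁(M) = π₁(N) = 1`
  (`IsConnectedSumOf.isConnectedSumOfSpheres_of_simplyConnectedSpace`, Kosinski VI.2); and
  conversely (`…_of_connectedSum_spheres`), so the two named facts are equivalent
  (`hamilton_pic_classification_four_iff`), and
  `Literature.Lorentz.hamilton_pic_sphere_four_of_classification : … → hamilton_pic_sphere_four`
  (Cor. 1.2(a) from Thm. 1.1, the deduction left implicit on p. 3 of the source).

No `_holds` is claimed for `hamilton_pic_sphere_four`: the remaining debt is exactly
`hamilton_pic_classification_four`, i.e. the Ricci flow with surgery (Hamilton 1997 §§2–5,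
Chen–Zhu 2006).

## References

* R. S. Hamilton, *Four-manifolds with positive isotropic curvature*, Comm. Anal. Geom. 5 (1997)
  1–92: Thm. 1.1 (p. 2), Cor. 1.2 (p. 3), pp. 3–4. [Hamilton1997]
* B.-L. Chen, X.-P. Zhu, *Ricci flow with surgery on four-manifolds with positive isotropic
  curvature*, J. Differential Geom. 74 (2006) 177–264, Thm. 1.1 and Cor. 1.2 (arXiv:math/0504478,
  p. 3). [ChenZhu2006]
* A. Kosinski, *Differential Manifolds* (1993), Ch. VI §2, Prop. 2.1. [Kosinski1993]
* A. Hatcher, *Algebraic Topology* (2002), Prop. 1.40, Examples 1.43, 2.48. [HatcherAT2002]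
-/

noncomputable section

open scoped Manifold ContDiff

namespace Literature.Geometry.Riemannian

/-- Local notation: `𝔼 n` is the model Euclidean space `EuclideanSpace ℝ (Fin n)`. -/
local notation "𝔼 " n:arg => EuclideanSpace ℝ (Fin n)

/-- Local notation: `𝕊 n` is the unit sphere in `EuclideanSpace ℝ (Fin (n + 1))`. -/
local notation "𝕊 " n:arg => (Metric.sphere (0 : EuclideanSpace ℝ (Fin (n + 1))) 1)

/-! ### Hamilton's four model pieces -/

/-- **Hamilton's model pieces** (Comm. Anal. Geom. 5 (1997), Thm. 1.1, p. 2): a charted space `X`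
on `ℝ⁴` is a model piece iff it is
* diffeomorphic to the round sphere `𝕊⁴`, or
* a (standard) real projective 4-space `𝕊⁴/±1` (`Literature.IsRealProjectiveSpace 4 X`: a `C^∞` local
  diffeomorphism `𝕊⁴ → X` identifying exactly antipodal points), or
* a smooth mapping torus of the identity of `𝕊³` (`Literature.Topology.FourManifolds.IsMappingTorusOf`), i.e. the product
  `S³ × S¹`, the oriented `S³` bundle over `S¹`, or
* a smooth mapping torus of the reflection `Literature.sphereReflection (Literature.spherePole 2)` of `𝕊³` in
  the hyperplane orthogonal to the pole `Literature.spherePole 2 = e₀`, i.e. the twisted product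
  `S³ ×~ S¹`, "the only unoriented `S³` bundle over `S¹`".
[cite: Hamilton1997, Thm. 1.1 (p. 2)] -/
def IsHamiltonPICPiece (X : Type) [TopologicalSpace X] [ChartedSpace (𝔼 4) X] : Prop :=
  Nonempty (X ≃ₘ⟮𝓡 4, 𝓡 4⟯ 𝕊 4) ∨ Literature.Topology.FourManifolds.IsRealProjectiveSpace 4 X ∨
    Literature.Topology.FourManifolds.IsMappingTorusOf (I := 𝓡 3) (𝓡 4) X (Diffeomorph.refl (𝓡 3) (𝕊 3) ∞) ∨
    Literature.Topology.FourManifolds.IsMappingTorusOf (I := 𝓡 3) (𝓡 4) X (Literature.Topology.FourManifolds.sphereReflection (Literature.Topology.FourManifolds.spherePole 2))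

/-- The round sphere `𝕊⁴` is a model piece. [cite: Hamilton1997, Thm. 1.1 (p. 2)] -/
theorem isHamiltonPICPiece_sphere : IsHamiltonPICPiece (𝕊 4) :=
  Or.inl ⟨Diffeomorph.refl (𝓡 4) (𝕊 4) ∞⟩

/-- A manifold diffeomorphic to `𝕊⁴` is a model piece. [cite: Hamilton1997, Thm. 1.1 (p. 2)] -/
theorem IsHamiltonPICPiece.of_nonempty_diffeomorph_sphere {X : Type} [TopologicalSpace X]
    [ChartedSpace (𝔼 4) X] (h : Nonempty (X ≃ₘ⟮𝓡 4, 𝓡 4⟯ 𝕊 4)) : IsHamiltonPICPiece X :=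
  Or.inl h

/-- A real projective 4-space is a model piece. [cite: Hamilton1997, Thm. 1.1 (p. 2)] -/
theorem IsHamiltonPICPiece.of_isRealProjectiveSpace {X : Type} [TopologicalSpace X]
    [ChartedSpace (𝔼 4) X] (h : Literature.Topology.FourManifolds.IsRealProjectiveSpace 4 X) : IsHamiltonPICPiece X :=
  Or.inr (Or.inl h)

/-- **The class of model pieces is invariant under diffeomorphism** onto a `C^∞` manifold (so
that "`X` is diffeomorphic to a piece" and "`X` is a piece" agree): compose the diffeomorphism
with the witness (`IsRealProjectiveSpace.of_diffeomorph`; transport of mapping tori along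
diffeomorphisms of equally modelled manifolds, `IsMappingTorusOf.diffeomorph_comp`,
`MappingTorusTransportProofs.lean`). Consequently the closure `IsConnectedSumOf 4
IsHamiltonPICPiece` is diffeomorphism invariant too (`IsConnectedSumOf.of_diffeomorph`).
[cite: Hamilton1997, Thm. 1.1 (p. 2)] -/
theorem IsHamiltonPICPiece.of_diffeomorph {X : Type} [TopologicalSpace X] [ChartedSpace (𝔼 4) X]
    (h : IsHamiltonPICPiece X) {Y : Type} [TopologicalSpace Y] [ChartedSpace (𝔼 4) Y]
    [IsManifold (𝓡 4) ∞ Y] (e : X ≃ₘ⟮𝓡 4, 𝓡 4⟯ Y) : IsHamiltonPICPiece Y := by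
  rcases h with ⟨⟨f⟩⟩ | h | h | h
  · exact Or.inl ⟨e.symm.trans f⟩
  · exact Or.inr (Or.inl (h.of_diffeomorph e))
  · exact Or.inr (Or.inr (Or.inl (h.diffeomorph_comp e rfl)))
  · exact Or.inr (Or.inr (Or.inr (h.diffeomorph_comp e rfl)))

/-- The closure of Hamilton's pieces under connected sums is invariant under diffeomorphism onto a
`C^∞` manifold. [cite: Hamilton1997, Thm. 1.1 (p. 2)] -/
theorem isConnectedSumOf_isHamiltonPICPiece_of_diffeomorph {X : Type} [TopologicalSpace X]
    [ChartedSpace (𝔼 4) X] (h : Literature.Topology.FourManifolds.IsConnectedSumOf 4 IsHamiltonPICPiece X) {Y : Type}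
    [TopologicalSpace Y] [ChartedSpace (𝔼 4) Y] [IsManifold (𝓡 4) ∞ Y] (e : X ≃ₘ⟮𝓡 4, 𝓡 4⟯ Y) :
    Literature.Topology.FourManifolds.IsConnectedSumOf 4 IsHamiltonPICPiece Y :=
  h.of_diffeomorph (fun _ _ _ _ _ _ _ hX f => hX.of_diffeomorph f) e

/-- **The only simply connected model piece is `S⁴`.** `π₁(RP⁴) = ℤ₂ ≠ 1`
(`IsRealProjectiveSpace.not_simplyConnectedSpace`, Hatcher Ex. 1.43) and
`π₁(S³ × S¹) = π₁(S³ ×~ S¹) = ℤ ≠ 1` (`IsMappingTorusOf.not_simplyConnectedSpace`, Hatcher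
Prop. 1.40 / Ex. 2.48, `𝕊³` being path connected); this is the computation behind Hamilton's
passage from Thm. 1.1 to Cor. 1.2(a) (Comm. Anal. Geom. 5 (1997), p. 3).
[cite: HatcherAT2002, Example 1.43 and Prop. 1.40] -/
theorem IsHamiltonPICPiece.nonempty_diffeomorph_sphere_of_simplyConnectedSpace {X : Type}
    [TopologicalSpace X] [ChartedSpace (𝔼 4) X] (h : IsHamiltonPICPiece X)
    (hX : SimplyConnectedSpace X) : Nonempty (X ≃ₘ⟮𝓡 4, 𝓡 4⟯ 𝕊 4) := by
  haveI : PathConnectedSpace (𝕊 3) := by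
    rw [← isPathConnected_iff_pathConnectedSpace]
    refine isPathConnected_sphere ?_ 0 zero_le_one
    rw [← Module.finrank_eq_rank, finrank_euclideanSpace_fin]
    norm_num
  rcases h with h | h | h | h
  · exact h
  · exact absurd hX (h.not_simplyConnectedSpace (by norm_num))
  · exact absurd hX h.not_simplyConnectedSpace
  · exact absurd hX h.not_simplyConnectedSpace

/-! ### Hamilton's Main Theorem 1.1 (simply connected case) with the printed list of pieces -/

/-- NAMED FACT (**Hamilton 1997, Main Theorem 1.1**, Comm. Anal. Geom. 5 (1997), p. 2, "only if"
direction; proof by Ricci flow with surgery completed by **Chen–Zhu 2006**, Thm. 1.1 and Cor. 1.2,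
J. Differential Geom. 74, arXiv:math/0504478 p. 3), **in the case `π₁(M⁴) = 1`**, with the
printed conclusion: a compact four-manifold with no essential incompressible space-form admitting
a metric of positive isotropic curvature "is diffeomorphic to the sphere `S⁴`, the projective
space `RP⁴`, the product `S³ × S¹`, the twisted product `S³ ×~ S¹` which is the only unoriented
`S³` bundle over `S¹`, or a connected sum of the above". Rendering: `M : Type` Hausdorff, second
countable, compact, `C^∞` 4-manifold on `ℝ⁴`, simply connected — which makes the space-form
hypothesis vacuous (an incompressible space form `S³/Γ ⊂ M` has `π₁(S³/Γ) = Γ` injecting into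
`π₁(M) = 1`, so `Γ = 1` and it is not essential, p. 2) —, carrying a smooth Riemannian metric with
`HasPositiveIsotropicCurvature` (the frame condition `R₁₃₁₃ + R₁₄₁₄ + R₂₃₂₃ + R₂₄₂₄ > 2R₁₂₃₄`,
p. 2); conclusion: `M` lies in the closure under connected sums (`Literature.IsConnectedSumOf 4`, the
tree's relational `Literature.Topology.FourManifolds.IsConnectedSum` iterated in any bracketing) of the class of the four model
pieces `IsHamiltonPICPiece`. Users take `(h : hamilton_pic_classification_four)`; the topological
deduction of Cor. 1.2(a) from it is proved below. Not attempted: the proof is the Ricci flow with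
surgery (Hamilton 1997 §§2–5, Chen–Zhu 2006 §§2–5 on Perelman's techniques).
[cite: Hamilton1997, Thm. 1.1 (p. 2)] [cite: ChenZhu2006, Thm. 1.1 and Cor. 1.2 (arXiv p. 3)] -/
def hamilton_pic_classification_four : Prop :=
  ∀ (M : Type) [TopologicalSpace M] [T2Space M] [SecondCountableTopology M]
    [ChartedSpace (EuclideanSpace ℝ (Fin 4)) M] [IsManifold (𝓡 4) ∞ M] [CompactSpace M]
    [SimplyConnectedSpace M],
    (∃ g : Literature.Geometry.Lorentzian.PseudoRiemannianMetric (𝓡 4) ∞ (EuclideanSpace ℝ (Fin 4))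
        (TangentSpace (𝓡 4) : M → Type _), g.IsRiemannian ∧ g.HasPositiveIsotropicCurvature) →
      Literature.Topology.FourManifolds.IsConnectedSumOf 4 IsHamiltonPICPiece M

/-! ### Cor. 1.2(a) from Thm. 1.1 -/

/-- **Thm. 1.1 (printed pieces) ⇒ Thm. 1.1 (connected-sum-of-spheres form).** If a simply
connected `M` is an iterated connected sum of Hamilton's pieces then, all summands of a simply
connected connected sum being simply connected (Kosinski VI.2, `ConnectedSumSummands.lean`) and
the only simply connected piece being `S⁴`, `M` is a connected sum of copies of `S⁴`
(`IsConnectedSumOf.isConnectedSumOfSpheres_of_simplyConnectedSpace`) — Hamilton 1997, p. 3.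
[cite: Hamilton1997, Thm. 1.1 (p. 2) and Cor. 1.2(a) (p. 3)] -/
theorem hamilton_pic_connectedSum_spheres_four_of_classification
    (h : hamilton_pic_classification_four) : hamilton_pic_connectedSum_spheres_four := by
  intro M _ _ _ _ _ _ _ hg
  exact (h M hg).isConnectedSumOfSpheres_of_simplyConnectedSpace (by norm_num)
    (fun X _ _ hX hXsc => hX.nonempty_diffeomorph_sphere_of_simplyConnectedSpace hXsc) ‹_›

/-- Conversely the connected-sum-of-spheres form implies the printed form (a sphere is a piece;
`IsConnectedSumOf.mono`). [cite: Hamilton1997, Thm. 1.1 (p. 2)] -/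
theorem hamilton_pic_classification_four_of_connectedSum_spheres
    (h : hamilton_pic_connectedSum_spheres_four) : hamilton_pic_classification_four := by
  intro M _ _ _ _ _ _ _ hg
  have h' := Literature.Topology.FourManifolds.isConnectedSumOfSpheres_iff_isConnectedSumOf.1 (h M hg)
  exact h'.mono fun X _ _ hX => IsHamiltonPICPiece.of_nonempty_diffeomorph_sphere hX

/-- The two renderings of Hamilton's Thm. 1.1 for `π₁ = 1` — printed pieces
(`hamilton_pic_classification_four`) and copies of `S⁴` (`hamilton_pic_connectedSum_spheres_four`)
— are equivalent. [cite: Hamilton1997, Thm. 1.1 (p. 2) and Cor. 1.2(a) (p. 3)] -/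
theorem hamilton_pic_classification_four_iff :
    hamilton_pic_classification_four ↔ hamilton_pic_connectedSum_spheres_four :=
  ⟨hamilton_pic_connectedSum_spheres_four_of_classification,
    hamilton_pic_classification_four_of_connectedSum_spheres⟩

/-- **Hamilton 1997, Cor. 1.2(a) from Main Theorem 1.1** (Comm. Anal. Geom. 5 (1997), p. 3: "if
`π₁ = {1}`, `M⁴` is diffeomorphic to `S⁴`"): the named fact `hamilton_pic_sphere_four` follows from
Thm. 1.1 with its printed list of pieces, everything downstream of the Ricci flow being proved in
the tree (`π₁` of the pieces, `π₁` of connected sums, `S⁴ # S⁴ ≅ S⁴`).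
[cite: Hamilton1997, Cor. 1.2(a) (p. 3)] -/
theorem hamilton_pic_sphere_four_of_classification (h : hamilton_pic_classification_four) :
    hamilton_pic_sphere_four :=
  hamilton_pic_sphere_four_of_hamilton_pic_connectedSum_spheres_four
    (hamilton_pic_connectedSum_spheres_four_of_classification h)

/-- `hamilton_pic_sphere_four` (Cor. 1.2(a)) is equivalent to Thm. 1.1 in the printed-pieces form
for `π₁ = 1`. [cite: Hamilton1997, Thm. 1.1 (p. 2) and Cor. 1.2(a) (p. 3)] -/
theorem hamilton_pic_sphere_four_iff_classification :
    hamilton_pic_sphere_four ↔ hamilton_pic_classification_four :=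
  hamilton_pic_sphere_four_iff_hamilton_pic_connectedSum_spheres_four.trans
    hamilton_pic_classification_four_iff.symm

/-- The duplicate vending `Literature.Geometry.Riemannian.hamilton_chen_tang_zhu` (`HamiltonPIC.lean`) also
follows from Thm. 1.1 in the printed-pieces form. [cite: Hamilton1997, Cor. 1.2(a) (p. 3)] -/
theorem hamilton_chen_tang_zhu_of_classification (h : hamilton_pic_classification_four) :
    Literature.Geometry.Riemannian.hamilton_chen_tang_zhu :=
  hamilton_chen_tang_zhu_of_hamilton_pic_sphere_four (hamilton_pic_sphere_four_of_classification h)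

end Literature.Geometry.Riemannian
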